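import Summits.BirchSwinnertonDyer.BirchSwinnertonDyer.Theorems.RamifiedSevenEllipticUnitsValueOfKMCPerrinRiou
import Literature.NumberTheory.EllipticCurves.Kato2004.IwasawaH1FreeOfNoRationalTorsionProofs

/-!
# `W(ℚ)[7] = 0` on 𝒞₇, in the `torsionBy`-currency of Kato 12.4 (3) / 13.8

Crux workfile for `EllipticUnitValueSevenOfGZK` (stmt-BirchSwinnertonDyer-19945), crux idea
`kato-member-transport` (Ideas/kato-member-transport.md), critic idea-crit-15 V#22be nit n1:
«state W(ℚ)[7] = 0 as the lemma it is, `torsionBy 7 = ⊥` per member».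

The card's freeness lever is the tree theorem
`IwasawaH1Data.moduleFree_of_torsionBy_eq_bot … (hK : AddSubgroup.torsionBy W.toAffine.Point (p : ℤ) = ⊥)`
(Kato 2004 Thm. 12.4 (3) via §13.8, no irreducibility). On 𝒞₇ its hypothesis at `p = 7` is a THEOREM of
the tree, not an assumption: `ValueOfKMCPerrinRiou.not_seven_dvd_torsionOrder` (`7 ∤ #W(ℚ)_tors` for every
`W ∈ 𝒞₇`, from the CM field discriminant `−7`; Silverman AEC Ex. 3.7, VII.3.1) plus finiteness of
`E(ℚ)_tors` (`finite_torsion_point`). This file is the one-line bridge; nothing else is claimed and no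
summit statement is proved by this seat (planner bsd-idea-20 g52).
-/

set_option autoImplicit false
set_option linter.dupNamespace false

open WeierstrassCurve
open Literature.NumberTheory.EllipticCurves Literature.NumberTheory.EllipticCurves.Kato2004
  Literature.NumberTheory.EllipticCurves.IwasawaAlgebra
open Summit.BirchSwinnertonDyer.Rank1Residual
open Summit.BirchSwinnertonDyer.BirchSwinnertonDyer.Theorems.RamifiedSevenEllipticUnits

namespace Summit.BirchSwinnertonDyer.BirchSwinnertonDyer.Cruxes.EllipticUnitValueSevenOfGZK.KatoMemberTransport

/-- **Bridge (any elliptic `W/ℚ`, any prime `p`): `p ∤ #W(ℚ)_tors ⟹ W(ℚ)[p] = 0`** in the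
`AddSubgroup.torsionBy … (p : ℤ) = ⊥` shape consumed by `IwasawaH1Data.moduleFree_of_torsionBy_eq_bot`.
A non-zero `P` with `p • P = 0` has order `p` inside the finite group `E(ℚ)_tors`, so `p ∣ #E(ℚ)_tors`.
[folklore] [cite: SilvermanAEC2009, Cor. VIII.6.7.1 (finiteness of `E(K)_tors`)] -/
theorem torsionBy_eq_bot_of_not_dvd_torsionOrder (W : WeierstrassCurve ℚ) [W.IsElliptic] (p : ℕ)
    [hp : Fact p.Prime] (h : ¬ p ∣ W.torsionOrder) :
    AddSubgroup.torsionBy W.toAffine.Point (p : ℤ) = ⊥ := by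
  -- `finite_torsion_point` / `torsionOrder` are stated over a general number field with the classical
  -- `DecidableEq`; over `ℚ` the group-law instance uses `instDecidableEqRat` — equal instances
  -- (`Subsingleton`), bridged by `convert`.
  haveI hfin : Finite (AddCommGroup.torsion W.toAffine.Point) := by
    convert W.finite_torsion_point
  have h' : ¬ p ∣ Nat.card (AddCommGroup.torsion W.toAffine.Point) := by
    unfold WeierstrassCurve.torsionOrder at h
    convert h
  refine (AddSubgroup.eq_bot_iff_forall _).mpr fun P hP ↦ ?_
  by_contra hP0
  have hpP : p • P = 0 := AddSubgroup.torsionBy.nsmul_iff.mp hP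
  have hord : addOrderOf P = p := addOrderOf_eq_prime hpP hP0
  have hmem : P ∈ AddCommGroup.torsion W.toAffine.Point :=
    (AddCommGroup.mem_torsion P).2 (isOfFinAddOrder_iff_nsmul_eq_zero.2 ⟨p, hp.out.pos, hpP⟩)
  exact h' (hord ▸ AddSubgroup.addOrderOf_dvd_natCard _ hmem)

/-- **nit n1 as a lemma: on 𝒞₇, `W(ℚ)[7] = 0`** (`AddSubgroup.torsionBy W(ℚ) 7 = ⊥`) for EVERY member —
the hypothesis `hK` of `IwasawaH1Data.moduleFree_of_torsionBy_eq_bot` at `p = 7`, so the strict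
`Δ`-trivial `𝐇¹_Γ(T₇W)` is `Λ`-free at every `W ∈ 𝒞₇` although `W[7]` is reducible (card lever (i)).
Tree inputs only: `ValueOfKMCPerrinRiou.not_seven_dvd_torsionOrder` + the bridge above.
[cite: SilvermanAEC2009, Exercise 3.7 and VII.3 Prop. 3.1] -/
theorem torsionBy_seven_eq_bot_of_classCSeven (W : WeierstrassCurve ℚ) [W.IsElliptic]
    [W.IsGloballyMinimal] [Fact (Nat.Prime 7)] (h7 : X12.ClassCSeven W) :
    AddSubgroup.torsionBy W.toAffine.Point ((7 : ℕ) : ℤ) = ⊥ :=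
  torsionBy_eq_bot_of_not_dvd_torsionOrder W 7 (ValueOfKMCPerrinRiou.not_seven_dvd_torsionOrder W h7)

/-- **The card's lever (i) as a kernel theorem: on 𝒞₇ the strict `Δ`-trivial `𝐇¹_Γ(T₇W)` is `Λ`-FREE at
EVERY member** — Kato Thm. 12.4 (3) / §13.8 in the tree's `IwasawaH1Data` currency
(`IwasawaH1Data.moduleFree_of_torsionBy_eq_bot`), its only hypothesis `W(ℚ)[7] = 0` discharged by
`torsionBy_seven_eq_bot_of_classCSeven`; no irreducibility of `W[7]` (which FAILS on 𝒞₇) is used.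
[cite: Kato2004Asterisque, Thm. 12.4 (3) (p. 221), §13.8 (pp. 228–229)] -/
theorem moduleFree_iwasawaH1_of_classCSeven (W : WeierstrassCurve ℚ) [W.IsElliptic]
    [W.IsGloballyMinimal] [Fact (Nat.Prime 7)] [ContinuousSMul ℤ_[7] (W.tateModule 7)]
    {κ : ZpExtension ℚ 7} {γ : Field.absoluteGaloisGroup ℚ} (hκ : κ.IsCyclotomic)
    (hγ : κ.IsTopGenerator γ) (I : IwasawaH1Data W 7 κ γ) (h7 : X12.ClassCSeven W) :
    Module.Free (IwasawaAlgebra 7) I.H :=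
  I.moduleFree_of_torsionBy_eq_bot hκ hγ (torsionBy_seven_eq_bot_of_classCSeven W h7)

end Summit.BirchSwinnertonDyer.BirchSwinnertonDyer.Cruxes.EllipticUnitValueSevenOfGZK.KatoMemberTransport
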